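import Literature.Geometry.Lorentzian.CarterThresholdTurningPoint
import HarnessLib

/-!
# The far turning point of a barrier whose profile is the threshold profile up to a fuzz `E`:
# location and affine two-sided control (radial variable)
(namespace `Literature.Geometry.Lorentzian.Kerr`.)

Generalisation of `CarterThresholdTurningPoint` from the threshold `ω = mω₊` to any frequency at which
Carter's coefficient obeys, on the radii of interest, the two-sided profile bounds
`Δ(J − E) ≤ (r² + a²)²(V − ω²) ≤ Δ(J + 3 + E)` with a constant fuzz `E ≥ 0`
(`J(r) = Λ′ − ω²(r + r₊)²(r − r₊)/(r − r₋)` the threshold profile; at the threshold `E = 0`,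
`CarterThresholdRate`; in the threshold sliver `E = E*` of `CarterLayerRate` on `r ≥ r₊ + ζ`). With
`J(r_t) = 0` (`r_t − r₊ ≥ r₊ − r₋`) and a true turning point `V(r_b) = ω²` (`r_b − r₊ ≥ r₊ − r₋`):

* `layer_turningRadius` — `−3 − E ≤ J(r_b) ≤ E`, `ω²(r_t + r₊)(r_b − r_t) ≤ 3 + E` and
  `ω²(r_b + r₊)(r_t − r_b) ≤ E` (the two turning radii are within `O((1 + E)/(ω²r))` of each other);
* `sq_mul_negCoeff_affine_bounds_of_layer` — for `r₊ < r ≤ r_b` where the profile bounds hold: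
  `Δ(r)(k(r)(r_b − r) − F₁) ≤ (r² + a²)²(V(r) − ω²) ≤ Δ(r)(C(r)(r_b − r) + C(r)E/(ω²(r_b + r₊)) + 3 + E)`,
  `k(r) = 2ω²(r + r₊)h(r)`, `C(r) = ω²(2(r_t + r₊) + (r_t + r₊)²/(r − r₋))`,
  `F₁ = 2(3 + E)(r_b + r₊)/(r_t + r₊) + 3 + 2E`
  (from `thresholdProfile_sub_ge/le/lt`; the anchoring at `r_b` absorbs `|r_b − r_t|`).

The profile bounds enter only as hypotheses at the two radii `r_b` and `r`. Input of the tortoise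
affine bound and of the last-layer geometry of the one-barrier kernel bound in the threshold sliver
(near-extremal Kerr programme, crux `KappaExplicitWaveDecay`).

## References
* M. Dafermos, I. Rodnianski, Y. Shlapentokh-Rothman, arXiv:1402.7034 = Ann. of Math. 183 (2016),
  §§5.2.3, 6.2–6.4 (key `DafermosRodnianskiShlapentokhrothman2014`). The assembly is folklore.
-/

noncomputable section

open Set

namespace Literature.Geometry.Lorentzian

namespace Kerr

section LayerTurningPoint

variable {M a ω Λ : ℝ} {m : ℤ}

/-- **The true turning point versus the profile zero, with fuzz.** `|a| < M`, `ω ≠ 0`, `0 ≤ E`,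
`J(r_t) = 0` with `r_t − r₊ ≥ r₊ − r₋`, `V(r_b) = ω²` with `r_b − r₊ ≥ r₊ − r₋`, and the profile bounds
at `r_b`. Then `−3 − E ≤ J(r_b) ≤ E`, `ω²(r_t + r₊)(r_b − r_t) ≤ 3 + E`, `ω²(r_b + r₊)(r_t − r_b) ≤ E`.
[folklore] -/
theorem layer_turningRadius (ha : |a| < M) (hω : ω ≠ 0) {E rt rb : ℝ} (hE : 0 ≤ E)
    (hrt : rPlus M a < rt) (hrtd : rPlus M a - rMinus M a ≤ rt - rPlus M a)
    (hJrt : Λ - 2 * a * m * ω - ω ^ 2 * (rt + rPlus M a) ^ 2 * ((rt - rPlus M a) / (rt - rMinus M a)) = 0)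
    (hrb : rPlus M a < rb) (hrbd : rPlus M a - rMinus M a ≤ rb - rPlus M a)
    (hV : sepPotential M a ω m Λ rb = ω ^ 2)
    (hlow : delta M a rb * (Λ - 2 * a * m * ω -
        ω ^ 2 * (rb + rPlus M a) ^ 2 * ((rb - rPlus M a) / (rb - rMinus M a)) - E) ≤
      (rb ^ 2 + a ^ 2) ^ 2 * (sepPotential M a ω m Λ rb - ω ^ 2))
    (hup : (rb ^ 2 + a ^ 2) ^ 2 * (sepPotential M a ω m Λ rb - ω ^ 2) ≤
      delta M a rb * (Λ - 2 * a * m * ω -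
        ω ^ 2 * (rb + rPlus M a) ^ 2 * ((rb - rPlus M a) / (rb - rMinus M a)) + 3 + E)) :
    -3 - E ≤ Λ - 2 * a * m * ω - ω ^ 2 * (rb + rPlus M a) ^ 2 * ((rb - rPlus M a) / (rb - rMinus M a)) ∧
    Λ - 2 * a * m * ω - ω ^ 2 * (rb + rPlus M a) ^ 2 * ((rb - rPlus M a) / (rb - rMinus M a)) ≤ E ∧
    ω ^ 2 * (rt + rPlus M a) * (rb - rt) ≤ 3 + E ∧ ω ^ 2 * (rb + rPlus M a) * (rt - rb) ≤ E := by
  have hM : 0 < M := lt_of_le_of_lt (abs_nonneg a) ha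
  have hrp : 0 < rPlus M a := rPlus_pos hM a
  have hsub : IsSubextremal M a := ha
  have hd0 : 0 < rPlus M a - rMinus M a := sub_pos.2 hsub.rMinus_lt_rPlus
  have hΔ : 0 < delta M a rb := delta_pos ha.le hrb
  have hω2 : 0 < ω ^ 2 := by positivity
  rw [hV, sub_self, mul_zero] at hlow hup
  set Jb := Λ - 2 * a * m * ω - ω ^ 2 * (rb + rPlus M a) ^ 2 * ((rb - rPlus M a) / (rb - rMinus M a))
    with hJb
  have hJbE : Jb ≤ E := by
    by_contra hcon; push Not at hcon
    have : 0 < delta M a rb * (Jb - E) := mul_pos hΔ (by linarith)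
    linarith
  have hJb3 : -3 - E ≤ Jb := by
    by_contra hcon; push Not at hcon
    have : delta M a rb * (Jb + 3 + E) < 0 := mul_neg_of_pos_of_neg hΔ (by linarith)
    linarith
  refine ⟨hJb3, hJbE, ?_, ?_⟩
  · -- `ω²(r_t + r₊)(r_b − r_t) ≤ 3 + E`
    rcases le_or_gt rt rb with hle | hgt
    · have hlin := thresholdProfile_sub_ge (ω := ω) (Λ := Λ) (m := m) ha hrt hle
      rw [hJrt] at hlin
      have hrtm : 0 < rt - rMinus M a := by linarith
      have hh : 1 / 2 ≤ (rt - rPlus M a) / (rt - rMinus M a) := by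
        rw [le_div_iff₀ hrtm]; linarith
      have hpos : 0 ≤ ω ^ 2 * (rt + rPlus M a) * (rb - rt) :=
        mul_nonneg (mul_nonneg hω2.le (by linarith)) (by linarith)
      have h3 : ω ^ 2 * (rt + rPlus M a) * (rb - rt) ≤
          2 * ω ^ 2 * (rt + rPlus M a) * ((rt - rPlus M a) / (rt - rMinus M a)) * (rb - rt) := by
        have := mul_le_mul_of_nonneg_left hh hpos
        calc ω ^ 2 * (rt + rPlus M a) * (rb - rt) = ω ^ 2 * (rt + rPlus M a) * (rb - rt) * (1 / 2) * 2 := by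
              ring
          _ ≤ ω ^ 2 * (rt + rPlus M a) * (rb - rt) * ((rt - rPlus M a) / (rt - rMinus M a)) * 2 := by
              nlinarith
          _ = 2 * ω ^ 2 * (rt + rPlus M a) * ((rt - rPlus M a) / (rt - rMinus M a)) * (rb - rt) := by ring
      simp only [hJb] at hJb3
      linarith
    · have : ω ^ 2 * (rt + rPlus M a) * (rb - rt) ≤ 0 :=
        mul_nonpos_of_nonneg_of_nonpos (mul_nonneg hω2.le (by linarith)) (by linarith)
      linarith
  · -- `ω²(r_b + r₊)(r_t − r_b) ≤ E`
    rcases le_or_gt rb rt with hle | hgt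
    · have hlin := thresholdProfile_sub_ge (ω := ω) (Λ := Λ) (m := m) ha hrb hle
      rw [hJrt, sub_zero] at hlin
      have hrbm : 0 < rb - rMinus M a := by linarith
      have hh : 1 / 2 ≤ (rb - rPlus M a) / (rb - rMinus M a) := by
        rw [le_div_iff₀ hrbm]; linarith
      have hpos : 0 ≤ ω ^ 2 * (rb + rPlus M a) * (rt - rb) :=
        mul_nonneg (mul_nonneg hω2.le (by linarith)) (by linarith)
      have h3 : ω ^ 2 * (rb + rPlus M a) * (rt - rb) ≤
          2 * ω ^ 2 * (rb + rPlus M a) * ((rb - rPlus M a) / (rb - rMinus M a)) * (rt - rb) := by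
        have := mul_le_mul_of_nonneg_left hh hpos
        calc ω ^ 2 * (rb + rPlus M a) * (rt - rb) = ω ^ 2 * (rb + rPlus M a) * (rt - rb) * (1 / 2) * 2 := by
              ring
          _ ≤ ω ^ 2 * (rb + rPlus M a) * (rt - rb) * ((rb - rPlus M a) / (rb - rMinus M a)) * 2 := by
              nlinarith
          _ = 2 * ω ^ 2 * (rb + rPlus M a) * ((rb - rPlus M a) / (rb - rMinus M a)) * (rt - rb) := by ring
      simp only [hJb] at hJbE
      linarith
    · have : ω ^ 2 * (rb + rPlus M a) * (rt - rb) ≤ 0 :=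
        mul_nonpos_of_nonneg_of_nonpos (mul_nonneg hω2.le (by linarith)) (by linarith)
      linarith

set_option maxHeartbeats 400000 in
-- two halves with a long common preamble
/-- **Affine two-sided control of the coefficient towards the true turning point, with fuzz.** Under
the hypotheses of `layer_turningRadius`, for `r₊ < r ≤ r_b` where the profile bounds hold:
`Δ(r)(k(r)(r_b − r) − F₁) ≤ (r² + a²)²(V(r) − ω²) ≤ Δ(r)(C(r)(r_b − r) + C(r)E/(ω²(r_b + r₊)) + 3 + E)`
with `k(r) = 2ω²(r + r₊)h(r)`, `C(r) = ω²(2(r_t + r₊) + (r_t + r₊)²/(r − r₋))`,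
`F₁ = 2(3 + E)(r_b + r₊)/(r_t + r₊) + 3 + 2E`. [folklore] -/
theorem sq_mul_negCoeff_affine_bounds_of_layer (ha : |a| < M) (hω : ω ≠ 0) {E rt rb : ℝ} (hE : 0 ≤ E)
    (hrt : rPlus M a < rt) (hrtd : rPlus M a - rMinus M a ≤ rt - rPlus M a)
    (hJrt : Λ - 2 * a * m * ω - ω ^ 2 * (rt + rPlus M a) ^ 2 * ((rt - rPlus M a) / (rt - rMinus M a)) = 0)
    (hrb : rPlus M a < rb) (hrbd : rPlus M a - rMinus M a ≤ rb - rPlus M a)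
    (hV : sepPotential M a ω m Λ rb = ω ^ 2)
    (hlowb : delta M a rb * (Λ - 2 * a * m * ω -
        ω ^ 2 * (rb + rPlus M a) ^ 2 * ((rb - rPlus M a) / (rb - rMinus M a)) - E) ≤
      (rb ^ 2 + a ^ 2) ^ 2 * (sepPotential M a ω m Λ rb - ω ^ 2))
    (hupb : (rb ^ 2 + a ^ 2) ^ 2 * (sepPotential M a ω m Λ rb - ω ^ 2) ≤
      delta M a rb * (Λ - 2 * a * m * ω -
        ω ^ 2 * (rb + rPlus M a) ^ 2 * ((rb - rPlus M a) / (rb - rMinus M a)) + 3 + E))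
    {r : ℝ} (hr : rPlus M a < r) (hrrb : r ≤ rb)
    (hlowr : delta M a r * (Λ - 2 * a * m * ω -
        ω ^ 2 * (r + rPlus M a) ^ 2 * ((r - rPlus M a) / (r - rMinus M a)) - E) ≤
      (r ^ 2 + a ^ 2) ^ 2 * (sepPotential M a ω m Λ r - ω ^ 2))
    (hupr : (r ^ 2 + a ^ 2) ^ 2 * (sepPotential M a ω m Λ r - ω ^ 2) ≤
      delta M a r * (Λ - 2 * a * m * ω -
        ω ^ 2 * (r + rPlus M a) ^ 2 * ((r - rPlus M a) / (r - rMinus M a)) + 3 + E)) :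
    delta M a r * (2 * ω ^ 2 * (r + rPlus M a) * ((r - rPlus M a) / (r - rMinus M a)) * (rb - r) -
          (2 * (3 + E) * (rb + rPlus M a) / (rt + rPlus M a) + 3 + 2 * E)) ≤
        (r ^ 2 + a ^ 2) ^ 2 * (sepPotential M a ω m Λ r - ω ^ 2) ∧
      (r ^ 2 + a ^ 2) ^ 2 * (sepPotential M a ω m Λ r - ω ^ 2) ≤
        delta M a r * (ω ^ 2 * (2 * (rt + rPlus M a) + (rt + rPlus M a) ^ 2 / (r - rMinus M a)) *
          (rb - r) + (ω ^ 2 * (2 * (rt + rPlus M a) + (rt + rPlus M a) ^ 2 / (r - rMinus M a)) *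
            (E / (ω ^ 2 * (rb + rPlus M a))) + 3 + E)) := by
  have hM : 0 < M := lt_of_le_of_lt (abs_nonneg a) ha
  have hrp : 0 < rPlus M a := rPlus_pos hM a
  have hsub : IsSubextremal M a := ha
  have hΔ : 0 ≤ delta M a r := delta_nonneg ha.le hr.le
  have hω2 : 0 < ω ^ 2 := by positivity
  obtain ⟨hJb3, hJbE, h3, h4⟩ := layer_turningRadius (Λ := Λ) ha hω hE hrt hrtd hJrt hrb hrbd hV hlowb hupb
  set Jr := Λ - 2 * a * m * ω - ω ^ 2 * (r + rPlus M a) ^ 2 * ((r - rPlus M a) / (r - rMinus M a))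
    with hJr
  set k := 2 * ω ^ 2 * (r + rPlus M a) * ((r - rPlus M a) / (r - rMinus M a)) with hk
  set Cr := ω ^ 2 * (2 * (rt + rPlus M a) + (rt + rPlus M a) ^ 2 / (r - rMinus M a)) with hCr
  have hrm : 0 < r - rMinus M a := by linarith [hsub.rMinus_lt_rPlus]
  have hhr : 0 ≤ (r - rPlus M a) / (r - rMinus M a) := div_nonneg (by linarith) hrm.le
  have hhr1 : (r - rPlus M a) / (r - rMinus M a) ≤ 1 := by
    rw [div_le_one hrm]; linarith [hsub.rMinus_lt_rPlus]
  have hk0 : 0 ≤ k := mul_nonneg (mul_nonneg (by positivity) (by linarith)) hhr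
  have hCr0 : 0 ≤ Cr := by
    have : 0 ≤ 2 * (rt + rPlus M a) + (rt + rPlus M a) ^ 2 / (r - rMinus M a) :=
      add_nonneg (by linarith) (div_nonneg (sq_nonneg _) hrm.le)
    exact mul_nonneg hω2.le this
  have hrtp0 : 0 < rt + rPlus M a := by linarith
  have hrbp0 : 0 < rb + rPlus M a := by linarith
  constructor
  · -- LOWER
    -- `J(r) ≥ k(r_t − r) − 3 − E`
    have hJ1 : k * (rt - r) - 3 - E ≤ Jr := by
      rcases le_or_gt r rt with hrrt | hrtr
      · have h := thresholdProfile_sub_ge (ω := ω) (Λ := Λ) (m := m) ha hr hrrt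
        rw [hJrt] at h
        simp only [hJr, hk]; linarith
      · have h1 : Jr ≥ -3 - E := by
          rcases hrrb.eq_or_lt with h | h
          · simp only [hJr]; rw [h]; exact hJb3
          · have := thresholdProfile_lt (ω := ω) (Λ := Λ) (m := m) ha hω hr h
            simp only [hJr]; linarith
        have h2 : k * (rt - r) ≤ 0 := mul_nonpos_of_nonneg_of_nonpos hk0 (by linarith)
        linarith
    -- `r_t − r ≥ (r_b − r) − (3 + E)/(ω²(r_t + r₊))` and `k(3 + E)/(ω²(r_t + r₊)) ≤ 2(3+E)(r_b+r₊)/(r_t+r₊)`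
    have hrbrt : rb - rt ≤ (3 + E) / (ω ^ 2 * (rt + rPlus M a)) := by
      rw [le_div_iff₀ (by positivity)]; linarith only [h3]
    have hk3 : k * ((3 + E) / (ω ^ 2 * (rt + rPlus M a))) ≤ 2 * (3 + E) * (rb + rPlus M a) / (rt + rPlus M a) := by
      have e : k * ((3 + E) / (ω ^ 2 * (rt + rPlus M a))) =
          2 * (3 + E) * ((r + rPlus M a) * ((r - rPlus M a) / (r - rMinus M a))) / (rt + rPlus M a) := by
        rw [hk]; field_simp
      rw [e, div_le_div_iff_of_pos_right hrtp0]
      have : (r + rPlus M a) * ((r - rPlus M a) / (r - rMinus M a)) ≤ (rb + rPlus M a) * 1 :=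
        mul_le_mul (by linarith only [hrrb]) hhr1 hhr (by linarith only [hrbp0])
      have hE3 : 0 ≤ 2 * (3 + E) := by linarith
      nlinarith [this, hE3]
    have hJ2 : k * (rb - r) - (2 * (3 + E) * (rb + rPlus M a) / (rt + rPlus M a) + 3 + 2 * E) ≤ Jr - E := by
      have := mul_le_mul_of_nonneg_left (show (rb - r) - (3 + E) / (ω ^ 2 * (rt + rPlus M a)) ≤ rt - r by
        linarith only [hrbrt]) hk0
      rw [mul_sub] at this
      linarith only [this, hk3, hJ1]
    calc delta M a r * (k * (rb - r) - (2 * (3 + E) * (rb + rPlus M a) / (rt + rPlus M a) + 3 + 2 * E))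
        ≤ delta M a r * (Jr - E) := mul_le_mul_of_nonneg_left hJ2 hΔ
      _ ≤ _ := hlowr
  · -- UPPER
    have hrtrb : rt - rb ≤ E / (ω ^ 2 * (rb + rPlus M a)) := by
      rw [le_div_iff₀ (by positivity)]; linarith only [h4]
    have hJup : Jr ≤ Cr * (rb - r) + Cr * (E / (ω ^ 2 * (rb + rPlus M a))) := by
      rcases le_or_gt r rt with hrrt | hrtr
      · have h := thresholdProfile_sub_le (ω := ω) (Λ := Λ) (m := m) ha hr hrrt
        rw [hJrt] at h
        have h2 : Cr * (rt - r) ≤ Cr * (rb - r) + Cr * (E / (ω ^ 2 * (rb + rPlus M a))) := by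
          rw [← mul_add]; exact mul_le_mul_of_nonneg_left (by linarith only [hrtrb]) hCr0
        simp only [hJr, hCr] at h h2 ⊢; linarith
      · have h1 : Jr ≤ 0 := by
          have := thresholdProfile_lt (ω := ω) (Λ := Λ) (m := m) ha hω hrt hrtr
          rw [hJrt] at this
          simp only [hJr]; linarith
        have h2 : 0 ≤ Cr * (rb - r) + Cr * (E / (ω ^ 2 * (rb + rPlus M a))) :=
          add_nonneg (mul_nonneg hCr0 (by linarith)) (mul_nonneg hCr0 (by positivity))
        linarith
    calc (r ^ 2 + a ^ 2) ^ 2 * (sepPotential M a ω m Λ r - ω ^ 2) ≤ delta M a r * (Jr + 3 + E) := hupr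
      _ ≤ _ := mul_le_mul_of_nonneg_left (by linarith) hΔ

end LayerTurningPoint

end Kerr

end Literature.Geometry.Lorentzian

end
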